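import Mathlib
import HarnessLib

/-!
# Very-well-poised hypergeometric series as Sorokin/Vasilyev-type multiple integrals (Zudilin 2002)

Topic `Literature/NumberTheory/Irrationality/Zudilin2002`. Typed, cited statement (no proof) of the
identity of W. Zudilin, *Very well-poised hypergeometric series and multiple integrals*, Russian Math.
Surveys **57**:4 (2002) 824–826 (arXiv:math/0206177, "Multiple-integral representations of very-well-poised
hypergeometric series"; the extract of *Well-poised hypergeometric service for diophantine problems of zeta
values*, J. Théor. Nombres Bordeaux 15 (2003)) [Zudilin2002VWPIntegrals], **Theorem**: for each `k ≥ 1`,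

`(∏_{j=1}^{k+1} Γ(1+h₀−h_j−h_{j+1})) / (Γ(h₁) Γ(h_{k+2})) · F_{k+2}(h₀; h₁, …, h_{k+2})
   = J_k(h₁; h₂, …, h_{k+1} | 1+h₀−h₃, …, 1+h₀−h_{k+2})`                                      (4)

where (1) `F_k(h₀;h₁,…,h_k) = Σ_{μ ≥ 0} (h₀+2μ) ∏_{j=0}^{k} Γ(h_j+μ)/Γ(1+h₀−h_j+μ) · (−1)^{(k+1)μ}` is the
very-well-poised `ₖ₊₂F_{k+1}(… | (−1)^{k+1})` series and (2)
`J_k(a₀; a₁,…,a_k | b₁,…,b_k) = ∫_{[0,1]^k} ∏_{j=1}^{k} x_j^{a_j−1}(1−x_j)^{b_j−a_j−1} / Q_k(x)^{a₀} dx` with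
(3) `Q₀ = 1`, `Q_k(x₁,…,x_k) = 1 − x₁ Q_{k−1}(x₂,…,x_k)`, "provided that (5) `1 + Re h₀ > (2/(k+1)) Σ_{j=1}^{k+2} Re h_j`,
(6) `Re(1+h₀−h_{j+1}) > Re h_j > 0` for `j = 2,…,k+1`, (7) `h₁, h_{k+2} ≠ 0, −1, −2, …`."

This is the dictionary "very-well-poised series = Sorokin/Vasilyev multiple integral" invoked by
Brown–Zudilin (arXiv:2210.03391 §9, refs [23] Zlobin 2002 Thm 2, [26] Zudilin 2003 Thm 5) to identify the
cellular family `₈π₈^∨` with the series `F₇(b)`; the cases `k = 2, 3` are the Beukers/Rhin–Viola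
integrals for `ζ(2), ζ(3)`. HONEST FRAMING (cell pub-zeta5): systematic search; no irrationality claim
unless certified — an identity of special functions, no arithmetic claim.

## Correction (same day, after referee Round 4 (v) of the cell): `vwp_eq_integral` is MIS-STATED
The verbatim transcription `vwp_eq_integral` of (4) under exactly the printed provisos (5)–(7) is
**false as a Lean proposition** (the `example : ¬ vwp_eq_integral` closing this file — a machine-checked refutation): the
printed (5)–(7) do not keep the numerator factor `Γ(1+h₀−h₁−h₂)` (j = 1) away from its poles — in print
the identity is one of meromorphic functions, read by analytic continuation there (the Remark after (7)
says as much for (7)) — and Mathlib's TOTAL `Real.Gamma` takes the value `0` at the poles, so at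
`k = 1`, `(h₀,h₁,h₂,h₃) = (1,1,1,−5/2)` (allowed by (5)–(7)) the typed left-hand side is `0` while the
integral `J₁ = ∫₀¹ (1−x)^{3/2} dx` is positive. USE `vwp_eq_integral_of_pos` (appended): the same identity
for POSITIVE real parameters with `h₁ + h₂ < 1 + h₀`, under which every Gamma value in (1) and (4) is
taken at a positive argument (this covers all the integer parameters of the arithmetic applications,
e.g. Brown–Zudilin's `F₇(b)`); the body of `vwp_eq_integral` is left untouched (append-only rule) and must
not be used as a hypothesis.

## Contents
* `vwpSeries m h` — `F_m(h₀;h₁,…,h_m)` of (1) for REAL parameters `h : ℕ → ℝ` (only `h 0, …, h m` are used),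
  as a real `tsum` (junk `0` if not summable; (5) guarantees summability in the source);
* `nestedQ`, `sorokinIntegrand`, `sorokinIntegral k a₀ a b` — `Q_k` of (3) and `J_k` of (2) over the
  closed cube `[0,1]^k` (`Fin k → ℝ`, product Lebesgue measure, Bochner integral, real powers `rpow`);
* `vwp_eq_integral` — the NAMED FACT (4) with (5)–(7), for real parameters.
  TODO(general form): the source states (4) for complex `h` (with `Re` in (5)–(6)); only the real case is
  typed here (all number-theoretic applications use integer `h`). General (complex-parameter) form: a theorem of
  the tree, `Summits/KontsevichZagierPeriods/Zeta5Search/VWPInduction.lean` `identity` (p533667; every `n ≥ 1` under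
  (5), (6) and positivity); a Literature restatement awaits a port of its import chain (XL, not scheduled).

Not here: the permutation group `𝔊` of order `(k+2)!` and the arithmetic corollary
`D_n^{k+1}Φ_n^{−1}J_{k,n} ∈ ℤζ(k)+…+ℤζ(3)+ℤ` (which rests on [Zu1, Lemmas 4.2–4.4], not restated in this
source), Lemmas 1–2 and the inductive proof.
-/

noncomputable section

open MeasureTheory Set

namespace Literature.NumberTheory.Irrationality.Zudilin2002

/-- The very-well-poised series (1):
`F_m(h₀;h₁,…,h_m) = Σ_{μ≥0} (h₀+2μ) · ∏_{j=0}^{m} Γ(h_j+μ)/Γ(1+h₀−h_j+μ) · (−1)^{(m+1)μ}`, real parameters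
`h 0, …, h m` (values of `h` above `m` are ignored). [cite: Zudilin2002VWPIntegrals, eq. (1)] -/
def vwpSeries (m : ℕ) (h : ℕ → ℝ) : ℝ :=
  ∑' μ : ℕ, (h 0 + 2 * μ) *
    (∏ j ∈ Finset.range (m + 1), Real.Gamma (h j + μ) / Real.Gamma (1 + h 0 - h j + μ)) *
    (-1 : ℝ) ^ ((m + 1) * μ)

/-- The nested kernels (3): `Q₀ = 1`, `Q_k(x₁,…,x_k) = 1 − x₁ · Q_{k−1}(x₂,…,x_k)`, on a list of variables.
[cite: Zudilin2002VWPIntegrals, eq. (3)] -/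
def nestedQ : List ℝ → ℝ
  | [] => 1
  | x :: xs => 1 - x * nestedQ xs

/-- The integrand of (2): `∏_{j=1}^{k} x_j^{a_j−1}(1−x_j)^{b_j−a_j−1} / Q_k(x₁,…,x_k)^{a₀}` (real powers),
with `a, b : ℕ → ℝ` read at `0,…,k−1` for `a₁,…,a_k`, `b₁,…,b_k`. [cite: Zudilin2002VWPIntegrals, eq. (2)] -/
def sorokinIntegrand (k : ℕ) (a₀ : ℝ) (a b : ℕ → ℝ) (x : Fin k → ℝ) : ℝ :=
  (∏ j : Fin k, (x j) ^ (a j - 1) * (1 - x j) ^ (b j - a j - 1)) /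
    (nestedQ (List.ofFn x)) ^ a₀

/-- The multiple integral `J_k(a₀; a₁,…,a_k | b₁,…,b_k)` of (2) over `[0,1]^k` (Bochner integral for the
product Lebesgue measure on `Fin k → ℝ`; junk `0` if not integrable — (6) guarantees convergence in the
source). [cite: Zudilin2002VWPIntegrals, eq. (2)] -/
def sorokinIntegral (k : ℕ) (a₀ : ℝ) (a b : ℕ → ℝ) : ℝ :=
  ∫ x in Set.pi Set.univ (fun _ : Fin k => Set.Icc (0 : ℝ) 1), sorokinIntegrand k a₀ a b x

/-- **MIS-STATED — do not use as a hypothesis** (Lean-false: refuted by the `example` closing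
this file, at the pole parameters `k = 1`, `h = (1,1,1,−5/2)`; corrected statement:
`vwp_eq_integral_of_pos`). Verbatim transcription kept for the record (append-only rule):
**Theorem** of [Zudilin2002VWPIntegrals] (named fact, statement only; real parameters): for `k ≥ 1`
and `h : ℕ → ℝ` with (5) `1 + h₀ > (2/(k+1)) Σ_{j=1}^{k+2} h_j`, (6) `1 + h₀ − h_{j+1} > h_j > 0` for
`j = 2,…,k+1`, (7) `h₁, h_{k+2} ∉ {0,−1,−2,…}`, the identity (4) holds:
`(∏_{j=1}^{k+1} Γ(1+h₀−h_j−h_{j+1}))/(Γ(h₁)Γ(h_{k+2})) · F_{k+2}(h₀;h₁,…,h_{k+2})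
 = J_k(h₁; h₂,…,h_{k+1} | 1+h₀−h₃,…,1+h₀−h_{k+2})`, i.e. `a₀ = h₁`, `a_j = h_{j+1}`, `b_j = 1+h₀−h_{j+2}`.
[cite: Zudilin2002VWPIntegrals, Theorem (eq. (4) with (5)–(7))] -/
def vwp_eq_integral : Prop :=
  ∀ (k : ℕ) (h : ℕ → ℝ), 1 ≤ k →
    (2 / ((k : ℝ) + 1)) * (∑ j ∈ Finset.Icc 1 (k + 2), h j) < 1 + h 0 →
    (∀ j ∈ Finset.Icc 2 (k + 1), 0 < h j ∧ h j < 1 + h 0 - h (j + 1)) →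
    (∀ n : ℕ, h 1 ≠ -(n : ℝ) ∧ h (k + 2) ≠ -(n : ℝ)) →
    (∏ j ∈ Finset.Icc 1 (k + 1), Real.Gamma (1 + h 0 - h j - h (j + 1))) /
          (Real.Gamma (h 1) * Real.Gamma (h (k + 2))) * vwpSeries (k + 2) h =
      sorokinIntegral k (h 1) (fun i => h (i + 2)) (fun i => 1 + h 0 - h (i + 3))

/-- **Theorem** of [Zudilin2002VWPIntegrals], eq. (4), for POSITIVE real parameters (named fact; PROVED
tree-side: `Summits/KontsevichZagierPeriods/Zeta5Search/VWPOfPos.lean` `vwp_eq_integral_of_pos_holds` (p536390) —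
not restated here because Literature cannot import Summits; the corrected form of `vwp_eq_integral`): for `k ≥ 1`
and `h : ℕ → ℝ` with the printed
(5) `1 + h₀ > (2/(k+1)) Σ_{j=1}^{k+2} h_j` and (6) `1 + h₀ − h_{j+1} > h_j > 0` (`j = 2,…,k+1`), and moreover
`h₀, h₁, h_{k+2} > 0` and `h₁ + h₂ < 1 + h₀` — so that (7) holds and EVERY Gamma value in (1) and (4)
(`Γ(h_j+μ)`, `Γ(1+h₀−h_j+μ)`, `Γ(1+h₀−h_j−h_{j+1})`, `Γ(h₁)`, `Γ(h_{k+2})`) is taken at a positive argument,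
away from the poles where the printed identity of meromorphic functions needs analytic continuation —
`(∏_{j=1}^{k+1} Γ(1+h₀−h_j−h_{j+1}))/(Γ(h₁)Γ(h_{k+2})) · F_{k+2}(h₀;h₁,…,h_{k+2})
 = J_k(h₁; h₂,…,h_{k+1} | 1+h₀−h₃,…,1+h₀−h_{k+2})`.
All integer parameter sets of the arithmetic applications (Ball–Rivoal, Zudilin, Brown–Zudilin `F₇(b)`)
satisfy these positivity conditions. [cite: Zudilin2002VWPIntegrals, Theorem (eq. (4) with (5)–(7)), positive-parameter case] -/
def vwp_eq_integral_of_pos : Prop :=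
  ∀ (k : ℕ) (h : ℕ → ℝ), 1 ≤ k →
    (2 / ((k : ℝ) + 1)) * (∑ j ∈ Finset.Icc 1 (k + 2), h j) < 1 + h 0 →
    (∀ j ∈ Finset.Icc 2 (k + 1), 0 < h j ∧ h j < 1 + h 0 - h (j + 1)) →
    0 < h 0 → 0 < h 1 → 0 < h (k + 2) → h 1 + h 2 < 1 + h 0 →
    (∏ j ∈ Finset.Icc 1 (k + 1), Real.Gamma (1 + h 0 - h j - h (j + 1))) /
          (Real.Gamma (h 1) * Real.Gamma (h (k + 2))) * vwpSeries (k + 2) h =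
      sorokinIntegral k (h 1) (fun i => h (i + 2)) (fun i => 1 + h 0 - h (i + 3))

/-- Build-time guard (an `example`, not a citable declaration): the verbatim transcription
`vwp_eq_integral` is Lean-false. At `k = 1`, `(h₀,h₁,h₂,h₃) = (1,1,1,−5/2)` — parameters allowed by the
printed (5)–(7) — the prefactor contains `Γ(1+h₀−h₁−h₂) = Γ(0)`, which is `0` for Mathlib's total
`Real.Gamma`, so the left-hand side is `0`, while the right-hand side is
`J₁(1; 1 | 7/2) = ∫_{[0,1]} (1−x)^{5/2}/(1−x) dx ≥ (1/2)·(1/2)^{3/2} > 0`. -/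
example : ¬ vwp_eq_integral := by
  intro H
  set h : ℕ → ℝ := fun j => if j = 3 then -(5 / 2 : ℝ) else 1 with hh
  have h5 : (2 / ((1 : ℕ) + 1 : ℝ)) * (∑ j ∈ Finset.Icc 1 (1 + 2), h j) < 1 + h 0 := by
    have : Finset.Icc 1 (1 + 2) = {1, 2, 3} := by decide
    rw [this]
    simp [hh]
    norm_num
  have h6 : ∀ j ∈ Finset.Icc 2 (1 + 1), 0 < h j ∧ h j < 1 + h 0 - h (j + 1) := by
    intro j hj
    rw [Finset.mem_Icc] at hj
    obtain rfl : j = 2 := by omega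
    simp [hh]
    norm_num
  have h7 : ∀ n : ℕ, h 1 ≠ -(n : ℝ) ∧ h (1 + 2) ≠ -(n : ℝ) := by
    intro n
    have hn : (0 : ℝ) ≤ n := n.cast_nonneg
    simp only [hh]
    norm_num
    constructor
    · intro e; linarith
    · intro e
      have e2 : ((2 * n : ℕ) : ℝ) = 5 := by push_cast; linarith
      norm_cast at e2
      omega
  have key := H 1 h le_rfl h5 h6 h7
  -- the left-hand side vanishes: the factor `j = 1` is `Γ(1 + 1 - 1 - 1) = Γ(0) = 0`
  have hL : (∏ j ∈ Finset.Icc 1 (1 + 1), Real.Gamma (1 + h 0 - h j - h (j + 1))) = 0 := by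
    refine Finset.prod_eq_zero (i := 1) (by decide) ?_
    simp [hh]
  rw [hL, zero_div, zero_mul] at key
  -- the right-hand side is a positive integral
  have hg : ∀ x : Fin 1 → ℝ, sorokinIntegrand 1 (h 1) (fun i => h (i + 2)) (fun i => 1 + h 0 - h (i + 3)) x =
      (1 - x 0) ^ ((5 : ℝ) / 2) / (1 - x 0) := by
    intro x
    simp [sorokinIntegrand, nestedQ, List.ofFn_succ, hh]
    norm_num
  have hI : sorokinIntegral 1 (h 1) (fun i => h (i + 2)) (fun i => 1 + h 0 - h (i + 3)) =
      ∫ x in Set.pi Set.univ (fun _ : Fin 1 => Icc (0 : ℝ) 1), (1 - x 0) ^ ((5 : ℝ) / 2) / (1 - x 0) := by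
    rw [sorokinIntegral]
    exact setIntegral_congr_fun (MeasurableSet.univ_pi fun _ => measurableSet_Icc) fun x _ => hg x
  rw [hI] at key
  -- positivity of the integral
  set cube : Set (Fin 1 → ℝ) := Set.pi Set.univ (fun _ : Fin 1 => Icc (0 : ℝ) 1) with hcube
  set half : Set (Fin 1 → ℝ) := Set.pi Set.univ (fun _ : Fin 1 => Icc (0 : ℝ) (1 / 2)) with hhalf
  set g : (Fin 1 → ℝ) → ℝ := fun x => (1 - x 0) ^ ((5 : ℝ) / 2) / (1 - x 0) with hgdef
  have hmc : MeasurableSet cube := MeasurableSet.univ_pi fun _ => measurableSet_Icc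
  have hmh : MeasurableSet half := MeasurableSet.univ_pi fun _ => measurableSet_Icc
  have hvol_c : volume cube = 1 := by
    rw [hcube, volume_pi, Measure.pi_pi]
    simp
  have hvol_h : volume half = ENNReal.ofReal (1 / 2) := by
    rw [hhalf, volume_pi, Measure.pi_pi]
    simp
  have hgm : Measurable g := by
    rw [hgdef]
    fun_prop
  have hg_eq : ∀ x : Fin 1 → ℝ, x 0 < 1 → g x = (1 - x 0) ^ ((3 : ℝ) / 2) := by
    intro x hx
    have hu : (1 - x 0) ≠ 0 := by linarith
    rw [hgdef]
    simp only []
    rw [show (5 : ℝ) / 2 = 3 / 2 + 1 by norm_num, Real.rpow_add_one hu, mul_div_cancel_right₀ _ hu]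
  have hg_nonneg : ∀ x ∈ cube, 0 ≤ g x := by
    intro x hx
    have hx0 : x 0 ∈ Icc (0 : ℝ) 1 := hx 0 (Set.mem_univ _)
    rw [hgdef]
    exact div_nonneg (Real.rpow_nonneg (by linarith [hx0.2]) _) (by linarith [hx0.2])
  have hg_le : ∀ x ∈ cube, ‖g x‖ ≤ 1 := by
    intro x hx
    have hx0 : x 0 ∈ Icc (0 : ℝ) 1 := hx 0 (Set.mem_univ _)
    rw [Real.norm_eq_abs, abs_of_nonneg (hg_nonneg x hx)]
    rcases eq_or_lt_of_le hx0.2 with h1 | h1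
    · rw [hgdef]
      simp [h1]
    · rw [hg_eq x h1]
      exact Real.rpow_le_one (by linarith) (by linarith [hx0.1]) (by norm_num)
  have hint : IntegrableOn g cube volume := by
    refine Measure.integrableOn_of_bounded (M := 1) (by rw [hvol_c]; exact ENNReal.one_ne_top)
      hgm.aestronglyMeasurable ?_
    exact (ae_restrict_iff' hmc).2 (Filter.Eventually.of_forall hg_le)
  have hsub : half ⊆ cube := Set.pi_mono fun _ _ => Icc_subset_Icc_right (by norm_num)
  have hlow : ∀ x ∈ half, (1 / 2 : ℝ) ^ ((3 : ℝ) / 2) ≤ g x := by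
    intro x hx
    have hx0 : x 0 ∈ Icc (0 : ℝ) (1 / 2) := hx 0 (Set.mem_univ _)
    rw [hg_eq x (by linarith [hx0.2])]
    exact Real.rpow_le_rpow (by norm_num) (by linarith [hx0.2]) (by norm_num)
  have step1 : ∫ x in half, g x ≤ ∫ x in cube, g x :=
    setIntegral_mono_set hint ((ae_restrict_iff' hmc).2 (Filter.Eventually.of_forall hg_nonneg))
      hsub.eventuallyLE
  have step2 : ∫ x in half, (fun _ => (1 / 2 : ℝ) ^ ((3 : ℝ) / 2)) x ≤ ∫ x in half, g x :=
    setIntegral_mono_on (integrableOn_const (by rw [hvol_h]; exact ENNReal.ofReal_ne_top))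
      (hint.mono_set hsub) hmh hlow
  have step3 : ∫ x in half, (fun _ => (1 / 2 : ℝ) ^ ((3 : ℝ) / 2)) x =
      (1 / 2 : ℝ) * (1 / 2 : ℝ) ^ ((3 : ℝ) / 2) := by
    rw [setIntegral_const, measureReal_def, hvol_h, ENNReal.toReal_ofReal (by norm_num), smul_eq_mul]
  have hpos : 0 < (1 / 2 : ℝ) * (1 / 2 : ℝ) ^ ((3 : ℝ) / 2) := by positivity
  have : 0 < ∫ x in cube, g x := by linarith
  exact this.ne' (by rw [hgdef] at key ⊢; exact key.symm)

end Literature.NumberTheory.Irrationality.Zudilin2002
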